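import Literature.Probability.Percolation.ZdBottomCluster
import Literature.Probability.Percolation.ZdFiveArmColumnDefs
import Literature.Probability.Percolation.AnnulusCircuitsProofs
import HarnessLib

/-!
# The open column path down to the explored cluster (five-arm lower bound for bond `ℤ²`, 5B)

Topic `Literature/Probability/Percolation`. Proofs only (no definition, no named fact) about
the open column event `colPathToCluster` of `ZdFiveArmColumnDefs.lean` in the five-arm lower
bound for bond percolation on `ℤ²` (see `ZdBottomCluster.lean`): Nolin's
"black path included in `[-N/8, 0] × [-N, N]`" joining the top side to the lowest crossing
(Nolin 2008, §5.2, proof of Thm. 24 (ii) [arXiv 0711.4948: Thm. 23 (ii)]: "with positive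
probability `c` is connected to the top side by a black path included in `[-N/8,0] × [-N,N]`"),
in the colour-swapped bond rendering where the explored object is the open cluster `O₀` of the
bottom side (`bottomCluster`) and the data-indexed event must be determined by the pairs NOT
examined by `{bottomCluster = O₀}` (`incidentPairs`), so that Kesten's decoupling applies
(`bondPercolation_real_inter_of_disjoint`; Bollobás–Riordan 2006, Ch. 3, proof of Lemma 4):

* `disjoint_offPairs_incidentPairs` — the pairs read by the column events are disjoint from the
  pairs examined by `{bottomCluster = O₀}`;
* `colPathToCluster_of_tbCrossingAt` — **a full open top–bottom crossing of the column implies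
  it**, as soon as the bottom sites of the column belong to `O₀` and the top sites do not: follow
  the crossing from the top and stop just before its first vertex in `O₀` (no planar topology);
* `crossingProb_le_real_colPathToCluster` — hence `P_p(colPathToCluster …) ≥ crossingProb p n (b - a)`.
-/

noncomputable section

open MeasureTheory Set SimpleGraph

namespace Literature.Probability.Percolation

open LatticeModels

variable {m n a b : ℕ} {O₀ : Finset (Site 2)} {ω : BondConfig (Site 2)}

/-- The pairs read by the column event are disjoint from the pairs examined by the cluster.
[folklore] -/
theorem disjoint_offPairs_incidentPairs (m n a b : ℕ) (O₀ : Finset (Site 2)) :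
    Disjoint (offPairs m n a b O₀) (incidentPairs m n O₀) := by
  classical
  rw [Finset.disjoint_left]
  intro e he he'
  rw [offPairs, Finset.mem_filter] at he
  rw [incidentPairs, Finset.mem_filter] at he'
  obtain ⟨x, hx, hxO⟩ := he'.2
  exact (he.2 x hx).2.2 hxO

/-! ### A full open crossing of the column implies the column event -/

/-- Along a walk whose dart sources avoid `O` and which ends in `O`, the last step enters `O`
from a vertex `u ∉ O`: the walk up to `u` lies in the support and off `O`. [folklore] -/
theorem ZdColumn.exists_walk_to_last {V : Type*} {G : SimpleGraph V} {O : Set V} :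
    ∀ {t v : V} (q : G.Walk t v), (∀ d ∈ q.darts, d.fst ∉ O) → v ∈ O → t ∉ O →
      ∃ (u : V) (q' : G.Walk t u), G.Adj u v ∧ (∀ z ∈ q'.support, z ∈ q.support ∧ z ∉ O) ∧
        ∀ e ∈ q'.edges, e ∈ q.edges
  | _, _, Walk.nil, _, hv, ht => absurd hv ht
  | t, v, Walk.cons (v := w) hadj q, hd, hv, ht => by
    by_cases hw : w ∈ O
    · -- the tail cannot continue off `O` from `w ∈ O` unless it is trivial
      cases q with
      | nil =>
        refine ⟨t, Walk.nil, hadj, fun z hz => ?_, fun e he => by simp at he⟩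
        rw [Walk.support_nil, List.mem_singleton] at hz
        subst hz
        exact ⟨by simp, ht⟩
      | cons hadj' q' =>
        exact absurd hw (hd ⟨(w, _), hadj'⟩ (by simp))
    · obtain ⟨u, q', huv, hs, he⟩ := ZdColumn.exists_walk_to_last q
        (fun d hd' => hd d (by simp [hd'])) hv hw
      refine ⟨u, Walk.cons hadj q', huv, fun z hz => ?_, fun e he' => ?_⟩
      · rw [Walk.support_cons, List.mem_cons] at hz
        rcases hz with rfl | hz
        · exact ⟨by simp, ht⟩
        · exact ⟨by simp [(hs z hz).1], (hs z hz).2⟩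
      · rw [Walk.edges_cons, List.mem_cons] at he'
        rcases he' with rfl | he'
        · simp
        · simp [he e he']

/-- **A full open top–bottom crossing of the column gives the column event** (Nolin 2008, proof
of Thm. 24 (ii), the use of a vertical crossing of the thin column; no planar topology is needed
in this direction): if the bottom sites of the column `[a,b] × [0,n]` (`b ≤ m`) lie in `O₀`, no
top site of `R` does, and the column is crossed from bottom to top by an open path, then,
following that path from the top, the vertex just before its first visit to `O₀` is the endpoint
of a witness of `colPathToCluster`. [cite: Nolin2008, §5.2, proof of Thm. 24 (ii) (arXiv 0711.4948: Thm. 23 (ii))] -/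
theorem colPathToCluster_of_tbCrossingAt (hω : ω ⊆ (zdGraph 2).edgeSet) (hbm : b ≤ m) (hab : a ≤ b)
    (hbot : ∀ x ∈ bottomSide m n, (a : ℤ) ≤ x 0 → x 0 ≤ b → x ∈ O₀)
    (htop : ∀ x ∈ topSide m n, x ∉ O₀)
    (h : ω ∈ openCrossing ((· + (![(a : ℤ), 0] : Site 2)) '' (rectangle (b - a) n : Set (Site 2)))
      ((· + (![(a : ℤ), 0] : Site 2)) '' (bottomSide (b - a) n : Set (Site 2)))
      ((· + (![(a : ℤ), 0] : Site 2)) '' (topSide (b - a) n : Set (Site 2)))) :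
    ω ∈ colPathToCluster m n a b O₀ := by
  classical
  obtain ⟨x, t, T, hx, ht, hTs, hTe⟩ := exists_walk_of_mem_tbCrossingAt hω h
  simp only [Matrix.cons_val_one, Matrix.cons_val_zero] at hx ht hTs
  have hba : (((b - a : ℕ) : ℤ)) = b - a := by omega
  -- coordinates of the walk
  have hTR : ∀ z ∈ T.support, z ∈ rectangle m n ∧ (a : ℤ) ≤ z 0 ∧ z 0 ≤ b := fun z hz => by
    obtain ⟨h0, h1, h2, h3⟩ := hTs z hz
    rw [hba] at h1
    exact ⟨mem_rectangle_iff.2 ⟨by omega, by omega, by omega, by omega⟩, h0, by omega⟩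
  have hxO : x ∈ O₀ := by
    obtain ⟨hxR, hxa, hxb⟩ := hTR x T.start_mem_support
    exact hbot x (Finset.mem_filter.2 ⟨hxR, hx⟩) hxa hxb
  have htO : t ∉ O₀ := by
    obtain ⟨htR, -, -⟩ := hTR t T.end_mem_support
    exact htop t (Finset.mem_filter.2 ⟨htR, by omega⟩)
  -- first visit to `O₀` from the top
  obtain ⟨v, hvO, q, hqs, hqe, hqd⟩ := exists_prefix_first_mem (O := (↑O₀ : Set (Site 2))) T.reverse
    ⟨x, by simp, Finset.mem_coe.2 hxO⟩
  obtain ⟨u, q', huv, hq's, hq'e⟩ := ZdColumn.exists_walk_to_last q hqd hvO (by exact_mod_cast htO)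
  have htT : t ∈ topSide m n := by
    obtain ⟨htR, -, -⟩ := hTR t T.end_mem_support
    exact Finset.mem_filter.2 ⟨htR, by omega⟩
  refine ⟨t, u, q', htT, fun z hz => ?_, fun e he => ?_, v, Finset.mem_coe.1 hvO, huv⟩
  · obtain ⟨hzq, hzO⟩ := hq's z hz
    have hzT : z ∈ T.support := by
      have := hqs z hzq; rwa [Walk.support_reverse, List.mem_reverse] at this
    obtain ⟨hzR, hza, hzb⟩ := hTR z hzT
    exact ⟨hzR, hza, hzb, fun h' => hzO (Finset.mem_coe.2 h')⟩
  · have := hqe e (hq'e e he)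
    rw [Walk.edges_reverse, List.mem_reverse] at this
    exact hTe e this

/-- **`P_p(colPathToCluster m n a b O₀) ≥ crossingProb p n (b - a)`** for `O₀` containing the bottom
sites of the column and no top site (`bondPercolation_real_tbCrossingAt`). [cite: Nolin2008, §5.2, proof of Thm. 24 (ii) (arXiv 0711.4948: Thm. 23 (ii))] -/
theorem crossingProb_le_real_colPathToCluster (p : unitInterval) (hbm : b ≤ m) (hab : a ≤ b)
    (hbot : ∀ x ∈ bottomSide m n, (a : ℤ) ≤ x 0 → x 0 ≤ b → x ∈ O₀)
    (htop : ∀ x ∈ topSide m n, x ∉ O₀) :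
    crossingProb p n (b - a) ≤ (bondPercolation (zdGraph 2) p).real (colPathToCluster m n a b O₀) := by
  rw [← bondPercolation_real_tbCrossingAt p (![(a : ℤ), 0]) (b - a) n]
  refine ENNReal.toReal_mono (measure_ne_top _ _) (measure_mono_ae ?_)
  filter_upwards [ae_subset_edgeSet (zdGraph 2) p] with ω hω h
  exact colPathToCluster_of_tbCrossingAt hω hbm hab hbot htop h

end Literature.Probability.Percolation
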